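import Literature.AlgebraicGeometry.Limits.LocalizationTwoOpensGlue
import HarnessLib

/-!
# Limits of schemes: two descended open charts glue to a descended scheme (Stacks 01ZM, two opens)

Topic: `Literature/AlgebraicGeometry/Limits`; conclusion of `Limits/LocalizationTwoOpensCharts` and
`Limits/LocalizationTwoOpensGlue`. Let `B = A_S`, `X` a `B`-scheme covered by two open charts
`uᵢ : Pᵢ ×_A Spec B → X` (`i = 1, 2`) which are base changes of `A`-schemes `Pᵢ` that are
quasi-compact, quasi-separated and locally of finite presentation, with quasi-compact
intersection `U ∩ V`. Then **`X` is the base change of an `A`-scheme which is again quasi-compact,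
quasi-separated and locally of finite presentation** (`exists_iso_pullback_of_two_charts`): the
comparison map `X → glued ⊗ Spec B` of `Limits/LocalizationTwoOpensGlue` is an isomorphism,
because over each of the two charts of `glued ⊗ Spec B` it restricts to an isomorphism — the
preimage of a chart of `glued ⊗ Spec B` is exactly the corresponding chart of `X`, since the two
charts of the pushout `glued` meet exactly in `Q₁ ⊗ Spec A[1/t]`
(`comparison_preimage_opensRange_inl`), and isomorphisms are Zariski-local on the target. This is
the induction step in the proof of EGA IV₃ 8.8.2 (ii) / Stacks 01ZM for
`Spec A_S = lim_s Spec A[1/s]` (`Limits/LocalizationSchemeDescent`).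

## References

* A. Grothendieck, EGA IV₃, Thm. 8.8.2 (ii) (Publ. Math. IHÉS 28, 1966). [EGAIV3]
* The Stacks project, Tag 01ZM. [StacksProject]
* U. Görtz, T. Wedhorn, *Algebraic Geometry I: Schemes*, 2nd ed. (2020), Thm. 10.66. [GortzWedhorn2020]
-/

noncomputable section

universe u

open CategoryTheory CategoryTheory.Limits AlgebraicGeometry TopologicalSpace MonoidalCategory
  CartesianMonoidalCategory
open Opposite

namespace Literature.AlgebraicGeometry.Limits

namespace LocApprox

open Literature.AlgebraicGeometry.Motives (SchemeOver specOver)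

set_option backward.isDefEq.respectTransparency false

variable {A : Type u} [CommRing A] {S : Submonoid A} {B : Type u} [CommRing B] [Algebra A B]
  [IsLocalization S B]

/-! ## The comparison map is an isomorphism -/

section IsIso

variable (B)
variable {X : SchemeOver B} {P₁ P₂ Q₁ Q₂ : SchemeOver A} (ι₁ : Q₁ ⟶ P₁) (ι₂ : Q₂ ⟶ P₂)
  [IsOpenImmersion ι₁.left] [IsOpenImmersion ι₂.left] (t : Idx S)
  (e : Q₁ ⊗ (baseDiagram S).obj t ≅ Q₂ ⊗ (baseDiagram S).obj t)
  (θ : Q₁ ⊗ specOver A B ≅ Q₂ ⊗ specOver A B) (hθ : θ.hom ≫ snd _ _ = snd _ _)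
  (hcomp : (Q₁ ◁ leg S B t) ≫ e.hom = θ.hom ≫ (Q₂ ◁ leg S B t))
  (u₁ : (Over.pullback (specOver A B).hom).obj P₁ ⟶ X)
  (u₂ : (Over.pullback (specOver A B).hom).obj P₂ ⟶ X)
  [IsOpenImmersion u₁.left] [IsOpenImmersion u₂.left]
  (hψ : (ι₁ ▷ specOver A B).left ≫ u₁.left = θ.hom.left ≫ (ι₂ ▷ specOver A B).left ≫ u₂.left)
  (hrange : Set.range ((ι₁ ▷ specOver A B).left ≫ u₁.left) = Set.range u₁.left ∩ Set.range u₂.left)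
  (hcov : Set.range u₁.left ∪ Set.range u₂.left = Set.univ)

omit [IsLocalization S B] [IsOpenImmersion ι₁.left] [IsOpenImmersion ι₂.left] in
/-- Precomposing with (the total-space component of) an isomorphism does not change the range.
[folklore] -/
theorem range_iso_hom_left_comp {Y : Scheme.{u}} {R₁ R₂ : SchemeOver A} (i : R₁ ≅ R₂)
    (g : R₂.left ⟶ Y) : Set.range (i.hom.left ≫ g) = Set.range g := by
  ext y
  constructor
  · rintro ⟨x, rfl⟩
    exact ⟨i.hom.left x, rfl⟩
  · rintro ⟨x, rfl⟩
    refine ⟨i.inv.left x, ?_⟩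
    change (i.inv.left ≫ i.hom.left ≫ g) x = g x
    rw [← Category.assoc, ← Over.comp_left, Iso.inv_hom_id, Over.id_left, Category.id_comp]

/-- The first comparison map followed by the projection to `glued`. [folklore] -/
theorem chartMap₁_fst : chartMap₁ B ι₁ ι₂ t e ≫
    pullback.fst (glued ι₁ ι₂ t e).hom (specOver A B).hom =
      (P₁ ◁ leg S B t).left ≫ (gluedInl ι₁ ι₂ t e).left := by
  change (toStage S B P₁ t ≫ (gluedInl ι₁ ι₂ t e ▷ specOver A B) ≫ fst _ _).left =
    ((P₁ ◁ leg S B t) ≫ gluedInl ι₁ ι₂ t e).left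
  rw [whiskerRight_fst, ← Category.assoc, toStage_fst]

/-- The second comparison map followed by the projection to `glued`. [folklore] -/
theorem chartMap₂_fst : chartMap₂ B ι₁ ι₂ t e ≫
    pullback.fst (glued ι₁ ι₂ t e).hom (specOver A B).hom =
      (P₂ ◁ leg S B t).left ≫ (gluedInr ι₁ ι₂ t e).left := by
  change (toStage S B P₂ t ≫ (gluedInr ι₁ ι₂ t e ▷ specOver A B) ≫ fst _ _).left =
    ((P₂ ◁ leg S B t) ≫ gluedInr ι₁ ι₂ t e).left
  rw [whiskerRight_fst, ← Category.assoc, toStage_fst]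

include hψ in
omit [IsOpenImmersion u₁.left] [IsOpenImmersion u₂.left] in
/-- **Key point for the second chart:** a point of `P₂ ⊗ Spec B` whose image under the comparison
map lies in the first chart of `glued ⊗ Spec B` maps into the first chart of `X`. [folklore] -/
theorem mem_range_u₁_of_chartMap₂_mem (z : (P₂ ⊗ specOver A B).left)
    (hz : chartMap₂ B ι₁ ι₂ t e z ∈ Set.range (gluedInl ι₁ ι₂ t e ▷ specOver A B).left) :
    u₂.left z ∈ Set.range u₁.left := by
  rw [range_whiskerRight_left, Set.mem_preimage] at hz
  have h1 : pullback.fst (glued ι₁ ι₂ t e).hom (specOver A B).hom (chartMap₂ B ι₁ ι₂ t e z) =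
      (gluedInr ι₁ ι₂ t e).left ((P₂ ◁ leg S B t).left z) :=
    congrArg (fun k => k z) (chartMap₂_fst B ι₁ ι₂ t e)
  rw [h1] at hz
  -- `(P₂ ◁ leg) z` lies in `inr ⁻¹' range inl = range glueRight = range (ι₂ ⊗ 1)`
  have hz' : (P₂ ◁ leg S B t).left z ∈ Set.range (ι₂ ▷ (baseDiagram S).obj t).left := by
    rw [← range_iso_hom_left_comp e, ← inr_preimage_range_inl (glueLeft ι₁ t) (glueRight ι₂ t e)]
    exact hz
  rw [← Set.mem_preimage, ← range_whiskerRight_left_eq_preimage ι₂ ((baseDiagram S).obj t)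
    (leg S B t)] at hz'
  obtain ⟨q, rfl⟩ := hz'
  obtain ⟨q', rfl⟩ : ∃ q', θ.hom.left q' = q := ⟨θ.inv.left q, by
    rw [← Scheme.Hom.comp_apply, ← Over.comp_left, Iso.inv_hom_id]; rfl⟩
  exact ⟨(ι₁ ▷ specOver A B).left q', congrArg (fun k => k q') hψ⟩

include hrange in
omit [IsOpenImmersion u₁.left] [IsOpenImmersion u₂.left] in
/-- **Key point for the first chart:** a point of `P₁ ⊗ Spec B` whose image under the comparison
map lies in the second chart of `glued ⊗ Spec B` maps into the second chart of `X`. [folklore] -/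
theorem mem_range_u₂_of_chartMap₁_mem (y : (P₁ ⊗ specOver A B).left)
    (hy : chartMap₁ B ι₁ ι₂ t e y ∈ Set.range (gluedInr ι₁ ι₂ t e ▷ specOver A B).left) :
    u₁.left y ∈ Set.range u₂.left := by
  rw [range_whiskerRight_left, Set.mem_preimage] at hy
  have h1 : pullback.fst (glued ι₁ ι₂ t e).hom (specOver A B).hom (chartMap₁ B ι₁ ι₂ t e y) =
      (gluedInl ι₁ ι₂ t e).left ((P₁ ◁ leg S B t).left y) :=
    congrArg (fun k => k y) (chartMap₁_fst B ι₁ ι₂ t e)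
  rw [h1] at hy
  have hy' : (P₁ ◁ leg S B t).left y ∈ Set.range (ι₁ ▷ (baseDiagram S).obj t).left := by
    rw [← inl_preimage_range_inr (glueLeft ι₁ t) (glueRight ι₂ t e)]
    exact hy
  rw [← Set.mem_preimage, ← range_whiskerRight_left_eq_preimage ι₁ ((baseDiagram S).obj t)
    (leg S B t)] at hy'
  obtain ⟨q, rfl⟩ := hy'
  have hq : u₁.left ((ι₁ ▷ specOver A B).left q) ∈ Set.range u₁.left ∩ Set.range u₂.left := by
    rw [← hrange]
    exact ⟨q, rfl⟩
  exact hq.2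

include hψ in
/-- The preimage of the first chart of `glued ⊗ Spec B` under the comparison map is the first
chart of `X`. [folklore] -/
theorem comparison_preimage_opensRange_inl :
    comparison B ι₁ ι₂ t e θ hθ hcomp u₁ u₂ hψ hrange hcov ⁻¹ᵁ
      (gluedInl ι₁ ι₂ t e ▷ specOver A B).left.opensRange = u₁.left.opensRange := by
  ext x
  change comparison B ι₁ ι₂ t e θ hθ hcomp u₁ u₂ hψ hrange hcov x ∈
    Set.range (gluedInl ι₁ ι₂ t e ▷ specOver A B).left ↔ x ∈ Set.range u₁.left
  constructor
  · intro hx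
    have hx' : x ∈ Set.range u₁.left ∪ Set.range u₂.left := by rw [hcov]; trivial
    rcases hx' with ⟨y, rfl⟩ | ⟨z, rfl⟩
    · exact ⟨y, rfl⟩
    · rw [← Scheme.Hom.comp_apply, u₂_comparison] at hx
      exact mem_range_u₁_of_chartMap₂_mem B ι₁ ι₂ t e θ u₁ u₂ hψ z hx
  · rintro ⟨y, rfl⟩
    rw [← Scheme.Hom.comp_apply, u₁_comparison]
    exact ⟨(toStage S B P₁ t).left y, rfl⟩

/-- The preimage of the second chart of `glued ⊗ Spec B` under the comparison map is the second
chart of `X`. [folklore] -/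
theorem comparison_preimage_opensRange_inr :
    comparison B ι₁ ι₂ t e θ hθ hcomp u₁ u₂ hψ hrange hcov ⁻¹ᵁ
      (gluedInr ι₁ ι₂ t e ▷ specOver A B).left.opensRange = u₂.left.opensRange := by
  ext x
  change comparison B ι₁ ι₂ t e θ hθ hcomp u₁ u₂ hψ hrange hcov x ∈
    Set.range (gluedInr ι₁ ι₂ t e ▷ specOver A B).left ↔ x ∈ Set.range u₂.left
  constructor
  · intro hx
    have hx' : x ∈ Set.range u₁.left ∪ Set.range u₂.left := by rw [hcov]; trivial
    rcases hx' with ⟨y, rfl⟩ | ⟨z, rfl⟩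
    · rw [← Scheme.Hom.comp_apply, u₁_comparison] at hx
      exact mem_range_u₂_of_chartMap₁_mem B ι₁ ι₂ t e u₁ u₂ hrange y hx
    · exact ⟨z, rfl⟩
  · rintro ⟨z, rfl⟩
    rw [← Scheme.Hom.comp_apply, u₂_comparison]
    exact ⟨(toStage S B P₂ t).left z, rfl⟩

/-- The comparison map restricts to an isomorphism over the first chart of `glued ⊗ Spec B`.
[folklore] -/
theorem isIso_comparison_morphismRestrict_inl :
    IsIso (comparison B ι₁ ι₂ t e θ hθ hcomp u₁ u₂ hψ hrange hcov ∣_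
      (gluedInl ι₁ ι₂ t e ▷ specOver A B).left.opensRange) := by
  refine isIso_morphismRestrict_of_preimage_eq _ u₁.left.opensRange _
    (u₁.left.isoOpensRange.inv ≫ ((Over.forget _).mapIso (stageIso S B P₁ t)).hom ≫
      (gluedInl ι₁ ι₂ t e ▷ specOver A B).left.isoOpensRange.hom) ?_
    (comparison_preimage_opensRange_inl B ι₁ ι₂ t e θ hθ hcomp u₁ u₂ hψ hrange hcov)
  rw [← Scheme.Hom.isoOpensRange_inv_comp u₁.left, Category.assoc, u₁_comparison, Category.assoc,
    Category.assoc, Scheme.Hom.isoOpensRange_hom_ι]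
  rfl

/-- The comparison map restricts to an isomorphism over the second chart of `glued ⊗ Spec B`.
[folklore] -/
theorem isIso_comparison_morphismRestrict_inr :
    IsIso (comparison B ι₁ ι₂ t e θ hθ hcomp u₁ u₂ hψ hrange hcov ∣_
      (gluedInr ι₁ ι₂ t e ▷ specOver A B).left.opensRange) := by
  refine isIso_morphismRestrict_of_preimage_eq _ u₂.left.opensRange _
    (u₂.left.isoOpensRange.inv ≫ ((Over.forget _).mapIso (stageIso S B P₂ t)).hom ≫
      (gluedInr ι₁ ι₂ t e ▷ specOver A B).left.isoOpensRange.hom) ?_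
    (comparison_preimage_opensRange_inr B ι₁ ι₂ t e θ hθ hcomp u₁ u₂ hψ hrange hcov)
  rw [← Scheme.Hom.isoOpensRange_inv_comp u₂.left, Category.assoc, u₂_comparison, Category.assoc,
    Category.assoc, Scheme.Hom.isoOpensRange_hom_ι]
  rfl

omit [IsLocalization S B] in
/-- The two charts of `glued ⊗ Spec B` cover it. [folklore] -/
theorem iSup_opensRange_whiskerRight_eq_top :
    (⨆ b : Bool, cond b (gluedInl ι₁ ι₂ t e ▷ specOver A B).left.opensRange
      (gluedInr ι₁ ι₂ t e ▷ specOver A B).left.opensRange) = ⊤ := by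
  rw [iSup_bool_eq, eq_top_iff]
  rintro x -
  change x ∈ Set.range (gluedInl ι₁ ι₂ t e ▷ specOver A B).left ∪
    Set.range (gluedInr ι₁ ι₂ t e ▷ specOver A B).left
  rw [range_whiskerRight_left, range_whiskerRight_left, ← Set.preimage_union]
  change pullback.fst (glued ι₁ ι₂ t e).hom (specOver A B).hom x ∈
    Set.range (pushout.inl (glueLeft ι₁ t) (glueRight ι₂ t e)) ∪
      Set.range (pushout.inr (glueLeft ι₁ t) (glueRight ι₂ t e))
  rw [range_inl_union_range_inr]
  trivial

/-- **The comparison map `X → glued ⊗ Spec B` is an isomorphism.** [folklore] -/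
theorem isIso_comparison : IsIso (comparison B ι₁ ι₂ t e θ hθ hcomp u₁ u₂ hψ hrange hcov) := by
  refine isIso_of_isIso_morphismRestrict _
    (fun b : Bool => cond b (gluedInl ι₁ ι₂ t e ▷ specOver A B).left.opensRange
      (gluedInr ι₁ ι₂ t e ▷ specOver A B).left.opensRange)
    (iSup_opensRange_whiskerRight_eq_top B ι₁ ι₂ t e) ?_
  rintro (_ | _)
  · exact isIso_comparison_morphismRestrict_inr B ι₁ ι₂ t e θ hθ hcomp u₁ u₂ hψ hrange hcov
  · exact isIso_comparison_morphismRestrict_inl B ι₁ ι₂ t e θ hθ hcomp u₁ u₂ hψ hrange hcov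

variable [QuasiCompact P₁.hom] [QuasiSeparated P₁.hom] [LocallyOfFinitePresentation P₁.hom]
  [QuasiCompact P₂.hom] [QuasiSeparated P₂.hom] [LocallyOfFinitePresentation P₂.hom]
  [QuasiCompact Q₁.hom]

include hθ hcomp hψ hrange hcov in
/-- **Gluing two descended charts** (the induction step of Stacks 01ZM / EGA IV₃ 8.8.2 (ii) for
`Spec A_S = lim Spec A[1/s]`): in the situation of this file, `X ≅ glued ×_A Spec B` over
`Spec B`, with `glued` quasi-compact, quasi-separated and locally of finite presentation over `A`.
[cite: StacksProject, Tag 01ZM] -/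
theorem exists_iso_pullback_glued :
    ∃ (P : SchemeOver A), QuasiCompact P.hom ∧ QuasiSeparated P.hom ∧
      LocallyOfFinitePresentation P.hom ∧
        Nonempty ((Over.pullback (specOver A B).hom).obj P ≅ X) := by
  haveI := isIso_comparison B ι₁ ι₂ t e θ hθ hcomp u₁ u₂ hψ hrange hcov
  refine ⟨glued ι₁ ι₂ t e, inferInstance, inferInstance, inferInstance, ⟨(Over.isoMk
    (asIso (comparison B ι₁ ι₂ t e θ hθ hcomp u₁ u₂ hψ hrange hcov)) ?_).symm⟩⟩
  exact comparison_snd B ι₁ ι₂ t e θ hθ hcomp u₁ u₂ hψ hrange hcov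

end IsIso

/-! ## Two descended charts with quasi-compact intersection glue to a descended scheme -/

section TwoCharts

variable (S B)

omit [IsLocalization S B] in

/-- **Stacks 01ZM for two opens.** Let `B = A_S` and let the `B`-scheme `X` be covered by two open
charts `u₁ : P₁ ×_A Spec B → X`, `u₂ : P₂ ×_A Spec B → X`, base changes of `A`-schemes `P₁, P₂`
which are quasi-compact, quasi-separated and locally of finite presentation, such that the
intersection of the two charts is quasi-compact. Then `X ≅ P ×_A Spec B` over `Spec B` for an
`A`-scheme `P` which is quasi-compact, quasi-separated and locally of finite presentation. Proof:
descend the overlap to quasi-compact opens `Oᵢ'` of a common stage `Pᵢ ⊗ Spec A[1/s]`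
(`exists_isCompact_preimage_eq₂`), identify the two descended overlaps over `Spec B`
(`overlapIso`), spread the identification out compatibly to a stage `t`
(`exists_iso_whiskerLeft_leg_comp_eq`) and glue (`exists_iso_pullback_glued`).
[cite: StacksProject, Tag 01ZM] [cite: EGAIV3, Thm. 8.8.2 (ii)] -/
theorem exists_iso_pullback_of_two_charts [IsLocalization S B] (X : SchemeOver B) (P₁ P₂ : SchemeOver A)
    [QuasiCompact P₁.hom] [QuasiSeparated P₁.hom] [LocallyOfFinitePresentation P₁.hom]
    [QuasiCompact P₂.hom] [QuasiSeparated P₂.hom] [LocallyOfFinitePresentation P₂.hom]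
    (u₁ : (Over.pullback (specOver A B).hom).obj P₁ ⟶ X)
    (u₂ : (Over.pullback (specOver A B).hom).obj P₂ ⟶ X)
    [IsOpenImmersion u₁.left] [IsOpenImmersion u₂.left]
    (hcov : Set.range u₁.left ∪ Set.range u₂.left = Set.univ)
    (hqc : IsCompact (Set.range u₁.left ∩ Set.range u₂.left)) :
    ∃ (P : SchemeOver A), QuasiCompact P.hom ∧ QuasiSeparated P.hom ∧
      LocallyOfFinitePresentation P.hom ∧
        Nonempty ((Over.pullback (specOver A B).hom).obj P ≅ X) := by
  have h₁ : IsCompact (overlap u₁ u₂ : Set (P₁ ⊗ specOver A B).left) := isCompact_overlap u₁ u₂ hqc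
  have h₂ : IsCompact (overlap u₂ u₁ : Set (P₂ ⊗ specOver A B).left) :=
    isCompact_overlap u₂ u₁ (by rwa [Set.inter_comm])
  obtain ⟨s, O₁', O₂', hO₁'c, hO₂'c, hO₁', hO₂'⟩ :=
    exists_isCompact_preimage_eq₂ S B P₁ P₂ (overlap u₁ u₂) h₁ (overlap u₂ u₁) h₂
  haveI := quasiCompact_chart_hom (P := P₁) hO₁'c
  haveI := quasiCompact_chart_hom (P := P₂) hO₂'c
  obtain ⟨t, e, -, hcomp⟩ := exists_iso_whiskerLeft_leg_comp_eq S B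
    (overlapIso u₁ u₂ O₁' O₂' hO₁' hO₂') (overlapIso_hom_snd u₁ u₂ O₁' O₂' hO₁' hO₂')
  exact exists_iso_pullback_glued B (chartι P₁ s O₁') (chartι P₂ s O₂') t e
    (overlapIso u₁ u₂ O₁' O₂' hO₁' hO₂') (overlapIso_hom_snd u₁ u₂ O₁' O₂' hO₁' hO₂') hcomp u₁ u₂
    (overlapIso_hom_left_overlapι u₁ u₂ O₁' O₂' hO₁' hO₂').symm (range_overlapι u₁ u₂ O₁' hO₁') hcov

end TwoCharts

end LocApprox

end Literature.AlgebraicGeometry.Limits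

end
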